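import Summits.CriticalPhenomena.PercolationContinuityZ3.Theorems.Transplant.CayleyMilnorGlideHcp
import Summits.CriticalPhenomena.PercolationContinuityZ3.Theorems.Transplant.CayleyScaledCentralCustomers
import HarnessLib

/-!
# The C3 conditional theorem in ONE statement: everything the one-type scaled node `SamePDropOfSkeletonFrmScaled₁` (`U_s`) buys —
# INPUT(G) = a transitive group of automorphisms with finite vertex stabilisers and first Betti number `≥ 2`, and its named instances

builds on p205010 (kernel theorem, internal audit signed; external expert review pending) — for the near-one gluing INSIDE the node's intended proof,
NOT for the implications below, which are tree theorems.  NOTHING is claimed about the node: `SamePDropOfSkeletonFrmScaled₁` is an OPEN `Prop`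
(hypothesis `hN`).  Lane `prim-bschramm`, seat `prim-bschramm-p4` gen 18 — the deliverable of PART C3 (`P4-GENERAL.md` §40, DIGEST v19):
"`AdditiveGluing + INPUT(G) ⇒ θ_G(p_c) = 0` with INPUT(G) as weak as we can make it, its Lean statement, and the list of graph classes where INPUT(G)
is known".  PROOF-ONLY packaging (no new mathematics; every conjunct is a named theorem of the files `CayleyMilnorKernel` (II), `CayleyMilnorTransitive`
(IV), `CayleyMilnorGlide` (VI), `CayleyMilnorGlideHcp` (VII), `CayleyScaledCentralCustomers`; the split-rank product row (8) is the separate file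
`CayleyMilnorTransitiveProd` (VIII), `AutScaled.boxProd_criticalContinuity_of_characters`, not imported here).  Helper file
(`--supports stmt-CriticalPhenomena-4575`).

THE STATEMENT (`frmScaledNode₁_consequences`).  Assume `U_s`.  Then `θ_v(p_c) = 0` at every vertex of:
(1) every connected locally finite graph carrying a TRANSITIVE action by automorphisms of a group `A` with FINITE vertex stabiliser and a homomorphism
    `A → ℤ²` of rank-2 image (`b₁(A) ≥ 2`) — the chart-free INPUT(G) of record;
(2) every Cayley graph `Cay(Γ; S)`, EVERY finite generating `S`, of every group `Γ` with a homomorphism to `ℤ²` of rank-2 image (`b₁(Γ) ≥ 2`);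
(3) every Cayley graph of `K × ℤ²`, `K` an ARBITRARY group (e.g. torsion of intermediate growth);
(4) every Cayley graph of `ℤ^d`, every `d ≥ 2` (every finite-range one-parameter bond model in every dimension);
(5) every connected locally finite graph on `ℤ³` invariant under the horizontal translations and one affine step `x ↦ (M x̄, x₂ + 1)` whose linear part
    `M` fixes a nonzero additive functional (the screw/glide criterion);
(6) the hexagonal close packing (`HcpOwnCriticalContinuity`, TARGET 2t of the lane's class map);
(7) `X □ Cay(Γ; S)` for every connected locally finite vertex-transitive `X` and `Γ`, `S` as in (2);
and, in file VIII (not restated here), (8) `X □ Y` whenever EACH factor carries a transitive finite-stabiliser action by automorphisms with a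
nontrivial character to `ℤ` (split rank).
Where INPUT is known (R-level list, P4-GENERAL §39.6/§40.6): `ℤ^d` (d ≥ 2), every finitely generated nilpotent / polycyclic / arbitrary group with
`b₁ ≥ 2` (ALL generating sets), `K × ℤ²`, hcp, acs, diamond-type two-class nets exchanged by a glide, products as in (7)/(8).  What it does not reach:
the multi-type wall (`vb₁ ≥ 2 > b₁`: lonsdaleite, nbo, sod, qtz, pyrochlore-bond, `(ℤ²⋊C₄)×ℤ`, …), chartless intermediate growth, site models, u2.
[cite: BenjaminiSchramm1996, Conj. 4; §2] [cite: KozmaNitzan2024, §1 p. 2 (approach 1); §4] [cite: MilnorSolvableGrowth1968, Lemma 1] [cite: Hutchcroft2016, Thm. 1.1]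
-/

noncomputable section

namespace Summit.CriticalPhenomena.PercolationContinuityZ3.Theorems.Transplant

open SimpleGraph MeasureTheory Literature.Probability.Percolation Literature.Probability.LatticeModels
open scoped Classical

/-- **ONE NODE ⇒ THE C3 CLASS LIST.**  `SamePDropOfSkeletonFrmScaled₁` implies `θ_v(p_c) = 0` at every vertex of: (1) every connected locally finite
graph with a transitive finite-stabiliser group of automorphisms mapping onto a rank-2 subgroup of `ℤ²`; (2) every Cayley graph (every finite
generating set) of every group with such a homomorphism; (3) every Cayley graph of `K × ℤ²`; (4) every Cayley graph of `ℤ^d`, `d ≥ 2`; (5) every graph on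
`ℤ³` invariant under the horizontal translations and one affine step with eigenvalue-1 linear part; (6) the hexagonal close packing; (7) `X □ Cay(Γ;S)`
with `X` vertex-transitive.  builds on p205010 (kernel theorem, internal audit signed;
external expert review pending) only inside the node's intended proof. [cite: BenjaminiSchramm1996, Conj. 4; §2] [cite: KozmaNitzan2024, §4]
[cite: MilnorSolvableGrowth1968, Lemma 1] [cite: Hutchcroft2016, Thm. 1.1] -/
theorem frmScaledNode₁_consequences (hN : SamePDropOfSkeletonFrmScaled₁) :
    -- (1) the chart-free INPUT(G)
    (∀ (V A : Type) [Group A] [MulAction A V] (G : SimpleGraph V) [G.LocallyFinite], IsActionByAut G A → G.Connected → ∀ t : V,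
      (∀ v : V, ∃ a : A, a • t = v) → (MulAction.stabilizer A t : Set A).Finite → ∀ c : A →* Multiplicative (Site 2),
      (∃ a b : A, MaxArea.det2 (Multiplicative.toAdd (c a)) (Multiplicative.toAdd (c b)) ≠ 0) →
      ∀ v : V, theta G v (criticalProbIOf G v) = 0) ∧
    -- (2) Cayley graphs, b₁ ≥ 2, every generating set
    (∀ (Γ : Type) [Group Γ] (φ : Γ →* Multiplicative (Site 2)),
      (∃ a b : Γ, MaxArea.det2 (Multiplicative.toAdd (φ a)) (Multiplicative.toAdd (φ b)) ≠ 0) →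
      ∀ S : Finset Γ, Subgroup.closure (S : Set Γ) = ⊤ → ∀ g : Γ, theta (mulCayley (S : Set Γ)) g (criticalProbIOf (mulCayley (S : Set Γ)) g) = 0) ∧
    -- (3) K × ℤ²
    (∀ (K : Type) [Group K] (S : Finset (K × Multiplicative (Site 2))), Subgroup.closure (S : Set (K × Multiplicative (Site 2))) = ⊤ →
      ∀ g, theta (mulCayley (S : Set (K × Multiplicative (Site 2)))) g (criticalProbIOf (mulCayley (S : Set (K × Multiplicative (Site 2)))) g) = 0) ∧
    -- (4) ℤ^d, every d ≥ 2, every generating set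
    (∀ d : ℕ, 2 ≤ d → ∀ S : Finset (Site d), AddSubgroup.closure (S : Set (Site d)) = ⊤ →
      ∀ v : Site d, theta (addCayley (S : Set (Site d))) v (criticalProbIOf (addCayley (S : Set (Site d))) v) = 0) ∧
    -- (5) the screw/glide criterion on ℤ³
    (∀ (M : Site 2 ≃+ Site 2) (G : SimpleGraph (Site 3)) [G.LocallyFinite], G.Connected →
      (∀ (u : Site 2) (x y : Site 3), G.Adj (x + Glide3.mk u 0) (y + Glide3.mk u 0) ↔ G.Adj x y) →
      (∀ x y : Site 3, G.Adj (Glide3.glide M x) (Glide3.glide M y) ↔ G.Adj x y) →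
      ∀ ℓ : Site 2 →+ ℤ, (∀ v, ℓ (M v) = ℓ v) → ∀ u₀ : Site 2, ℓ u₀ ≠ 0 → ∀ v : Site 3, theta G v (criticalProbIOf G v) = 0) ∧
    -- (6) hcp
    HcpOwnCriticalContinuity ∧
    -- (7) X □ Cay(Γ; S)
    (∀ (W Γ : Type) [Group Γ] (φ : Γ →* Multiplicative (Site 2)),
      (∃ a b : Γ, MaxArea.det2 (Multiplicative.toAdd (φ a)) (Multiplicative.toAdd (φ b)) ≠ 0) →
      ∀ S : Finset Γ, Subgroup.closure (S : Set Γ) = ⊤ → ∀ (X : SimpleGraph W) [X.LocallyFinite] (x₀ : W), (∀ x : W, ∃ γ : X ≃g X, γ x₀ = x) →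
      X.Connected → ∀ v : W × Γ, theta (X □ mulCayley (S : Set Γ)) v (criticalProbIOf (X □ mulCayley (S : Set Γ)) v) = 0) :=
  ⟨fun _ _ _ _ _ _ hact hc t htr hfin c hrank v => AutScaled.criticalContinuity hN hact hc t htr hfin c hrank v,
    fun _ _ φ hrank S hS g => CayleyScaled.criticalContinuity_of_rank hN φ hrank S hS g,
    fun K _ S hS g => CayleyScaled.criticalContinuity_prod_zTwo hN K S hS g,
    fun _ hd S hS v => ZdGens.criticalContinuity_of_frmScaledNode₁ hd hN S hS v,
    fun M G _ hc htr hgl ℓ hℓ u₀ hu₀ v => Glide3.criticalContinuity M hN G hc htr hgl ℓ hℓ u₀ hu₀ v,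
    hcpOwnCriticalContinuity_of_frmScaledNode₁ hN,
    fun _ _ _ φ hrank S hS X _ x₀ htr hc v => CayleyScaled.boxProd_criticalContinuity_of_rank hN φ hrank S hS X x₀ htr hc v⟩

end Summit.CriticalPhenomena.PercolationContinuityZ3.Theorems.Transplant

end
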